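import Summits.Parity.BatemanHorn.Theorems.AlmostPrimeZerosSystemLSDRealSegmentTruncatedLaw
import HarnessLib

/-!
# `SystemLSDRealSegment` (stmt-Parity-11292), line `beta-thinned-root-kernel`: the open kernel law at `(f, y)` IS the
# `y`-TILTED law of the prime factors above `x^θ` (lead c9)

For a Bateman–Horn system `f` and real `y > 1` let `s_f(n)` be the crux's capped statistic and `s_{f,S}(n)` its
truncation to the primes `< S` (`S = ⌊x^θ⌋₊ + 1`).  The landed truncated law (`…TruncatedLaw.lean`) evaluates
`Σ_{n≤x} y^{s_{f,S}(n)} ~ Re λ_f(y) (e^γ θ)^{k(y−1)} x (log x)^{k(y−1)}` up to `O(e^{−1/θ})`; dividing it out: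

* `truncStat_law_relative` — `∀ ε ∃ θ₁ ∀ θ ≤ θ₁`: eventually
  `|Σ_{n≤x} y^{s_{f,S}(n)}/(θ^{k(y−1)} x (log x)^{k(y−1)}) − Re λ_f(y) e^{γk(y−1)}| ≤ ε`;
* `segmentLawReal_iff_tiltedRoughLaw`, `betaKernelLaw_iff_tiltedRoughLaw` — the crux's segment law at `(f, y)`
  (equivalently `BetaKernelLaw k f y`, the registered open content) holds IFF for every `ε > 0` and all small `θ > 0`,
  eventually `|θ^{k(y−1)} · Σ_n y^{s_f(n)} / Σ_n y^{s_{f,S}(n)} − e^{−γk(y−1)} D^{y−1} Γ(y)^{−k}| ≤ ε` (`D = ∏ deg fᵢ`).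

The quotient `Σ_n y^{s_f(n)}/Σ_n y^{s_{f,S}(n)}` is the expectation of `y^{(number of capped prime factors ≥ S of the
values)}` under the probability measure on `{0,…,x}` with weights `∝ y^{s_{f,S}(n)}`: every class stub of the skeleton
is exactly a statement about the LARGE prime factors of the values under an explicit tilted measure, with a universal
target constant.  Everything is PROVED; no definitions.
-/

open Filter Finset Polynomial
open scoped BigOperators Topology

namespace Summit.Parity.BatemanHorn.Cruxes.SystemLSDRealSegment.BetaThinnedRootKernel

open Literature.NumberTheory.Sieve

noncomputable section

section Tilted

variable {k : ℕ} {f : Fin k → ℤ[X]}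

/-- `e^{−1/θ} θ^{−κ} → 0` as `θ → 0⁺`: for every `ε > 0` there is `θ₁ > 0` with `e^{−1/θ} θ^{−κ} ≤ ε` on `(0, θ₁]`.
[folklore] -/
theorem exists_exp_neg_inv_mul_rpow_neg_le (κ : ℝ) {ε : ℝ} (hε : 0 < ε) :
    ∃ θ₁ : ℝ, 0 < θ₁ ∧ ∀ θ : ℝ, 0 < θ → θ ≤ θ₁ → Real.exp (-1 / θ) * θ ^ (-κ) ≤ ε := by
  have h : Tendsto (fun u : ℝ => u ^ κ * Real.exp (-1 * u)) atTop (𝓝 0) :=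
    tendsto_rpow_mul_exp_neg_mul_atTop_nhds_zero κ 1 one_pos
  have h2 : Tendsto (fun θ : ℝ => θ⁻¹) (𝓝[>] 0) atTop := tendsto_inv_nhdsGT_zero
  have h3 := h.comp h2
  have hev : ∀ᶠ θ : ℝ in 𝓝[>] 0, (θ⁻¹) ^ κ * Real.exp (-1 * θ⁻¹) < ε := h3.eventually (Iio_mem_nhds hε)
  rw [eventually_nhdsWithin_iff, Metric.eventually_nhds_iff] at hev
  obtain ⟨r, hr, hrε⟩ := hev
  refine ⟨r / 2, by positivity, fun θ hθ hθr => ?_⟩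
  have hdist : dist θ 0 < r := by
    rw [Real.dist_eq, sub_zero, abs_of_pos hθ]; linarith
  have := hrε hdist hθ
  rw [Real.inv_rpow hθ.le, ← Real.rpow_neg hθ.le] at this
  rw [show (-1 : ℝ) / θ = -1 * θ⁻¹ by ring, mul_comm]
  exact this.le

/-- **The truncated law, relative form**: for a Bateman–Horn system `f`, real `y ≥ 1` and every `ε > 0` there is
`θ₁ > 0` such that for every `θ ∈ (0, θ₁]`, eventually in `x`,
`|Σ_{n≤x} y^{s_{f,⌊x^θ⌋₊+1}(n)} / (θ^{k(y−1)} x (log x)^{k(y−1)}) − Re λ_f(y) e^{γk(y−1)}| ≤ ε`. [folklore] -/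
theorem truncStat_law_relative (hf : IsBatemanHornSystem f) {y : ℝ} (hy : 1 ≤ y) {ε : ℝ} (hε : 0 < ε) :
    ∃ θ₁ : ℝ, 0 < θ₁ ∧ ∀ θ : ℝ, 0 < θ → θ ≤ θ₁ → ∀ᶠ x : ℕ in atTop,
      |(∑ n ∈ range (x + 1), y ^ (∑ i, (((f i).eval (n : ℤ)).toNat.factorization.sum
            fun p v => if p < ⌊(x : ℝ) ^ θ⌋₊ + 1 then min v 2 else 0))) /
          (θ ^ ((k : ℝ) * (y - 1)) * ((x : ℝ) * Real.log x ^ ((k : ℝ) * (y - 1)))) -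
        (eulerFactor f (y : ℂ)).re * Real.exp (Real.eulerMascheroniConstant * ((k : ℝ) * (y - 1)))| ≤ ε := by
  set κ : ℝ := (k : ℝ) * (y - 1) with hκ
  obtain ⟨C, hC, hlaw⟩ := truncStat_law_normalised hf hy
  obtain ⟨θ₁, hθ₁, hθ₁le⟩ := exists_exp_neg_inv_mul_rpow_neg_le κ (show 0 < ε / (2 * C) by positivity)
  refine ⟨min θ₁ 1, lt_min hθ₁ one_pos, fun θ hθ hθle => ?_⟩
  have hθ1 : θ ≤ 1 := hθle.trans (min_le_right _ _)
  have hθθ₁ : θ ≤ θ₁ := hθle.trans (min_le_left _ _)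
  have hθκ : 0 < θ ^ κ := Real.rpow_pos_of_pos hθ _
  filter_upwards [hlaw θ hθ hθ1 (ε / 2 * θ ^ κ) (by positivity)] with x hx
  set G : ℝ := (∑ n ∈ range (x + 1), y ^ (∑ i, (((f i).eval (n : ℤ)).toNat.factorization.sum
      fun p v => if p < ⌊(x : ℝ) ^ θ⌋₊ + 1 then min v 2 else 0))) / ((x : ℝ) * Real.log x ^ κ) with hG
  set Λ₀ : ℝ := (eulerFactor f (y : ℂ)).re * Real.exp (Real.eulerMascheroniConstant * κ) with hΛ₀
  -- divide the absolute law by `θ^κ`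
  have hdiv : (∑ n ∈ range (x + 1), y ^ (∑ i, (((f i).eval (n : ℤ)).toNat.factorization.sum
      fun p v => if p < ⌊(x : ℝ) ^ θ⌋₊ + 1 then min v 2 else 0))) / (θ ^ κ * ((x : ℝ) * Real.log x ^ κ)) =
      G / θ ^ κ := by
    rw [hG, div_div, mul_comm]
  rw [hdiv]
  have h1 : |G / θ ^ κ - Λ₀| = |G - Λ₀ * θ ^ κ| / θ ^ κ := by
    rw [show G / θ ^ κ - Λ₀ = (G - Λ₀ * θ ^ κ) / θ ^ κ by field_simp, abs_div, abs_of_pos hθκ]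
  rw [h1, div_le_iff₀ hθκ]
  have h2 : C * Real.exp (-1 / θ) ≤ ε / 2 * θ ^ κ := by
    have := hθ₁le θ hθ hθθ₁
    rw [Real.rpow_neg hθ.le, ← div_eq_mul_inv, div_le_iff₀ hθκ] at this
    calc C * Real.exp (-1 / θ) ≤ C * (ε / (2 * C) * θ ^ κ) := mul_le_mul_of_nonneg_left this hC.le
      _ = ε / 2 * θ ^ κ := by field_simp
  calc |G - Λ₀ * θ ^ κ| ≤ C * Real.exp (-1 / θ) + ε / 2 * θ ^ κ := hx
    _ ≤ ε / 2 * θ ^ κ + ε / 2 * θ ^ κ := by linarith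
    _ = ε * θ ^ κ := by ring

/-- **The crux at `(f, y)` is the law of the `y`-TILTED exponential moment of the number of prime factors `> x^θ`.**
For a Bateman–Horn system `f` and real `y > 1`, the real form of the crux's segment law at `y`
(`Σ_{n≤x} y^{s_f(n)} / (x (log x)^{k(y−1)}) → Re λ_f(y) · e^{(y−1) log D} Γ(y)^{−k}`, `D = ∏ deg fᵢ`; see
`segmentLaw_iff_tendsto_real`) holds IF AND ONLY IF: for every `ε > 0` and all small `θ > 0`, eventually in `x`,
`|θ^{k(y−1)} · Σ_{n≤x} y^{s_f(n)} / Σ_{n≤x} y^{s_{f,⌊x^θ⌋₊+1}(n)} − e^{−γk(y−1)} e^{(y−1) log D} Γ(y)^{−k}| ≤ ε`.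
The quotient is the expectation of `y^{s_f(n) − s_{f,S}(n)}` = `y^{#(capped) prime factors ≥ S of the values}` under
the probability measure on `{0,…,x}` with weights `∝ y^{s_{f,S}(n)}` (`S = ⌊x^θ⌋₊ + 1`): the open content of the crux is
EXACTLY the `y`-tilted law of the large prime factors, with the universal constant `e^{−γk(y−1)} D^{y−1} Γ(y)^{−k} θ^{−k(y−1)}`.
[folklore] -/
theorem segmentLawReal_iff_tiltedRoughLaw (hf : IsBatemanHornSystem f) {y : ℝ} (hy : 1 < y) :
    Tendsto (fun x : ℕ => (∑ n ∈ range (x + 1),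
        y ^ (∑ i, (((f i).eval (n : ℤ)).toNat.factorization.sum fun _ v => min v 2))) /
          ((x : ℝ) * Real.log x ^ ((k : ℝ) * (y - 1)))) atTop
      (𝓝 ((eulerFactor f (y : ℂ)).re *
        (Real.exp ((y - 1) * Real.log (∏ i, ((f i).natDegree : ℝ))) * (Real.Gamma y)⁻¹ ^ k))) ↔
    ∀ ε : ℝ, 0 < ε → ∃ θ₀ : ℝ, 0 < θ₀ ∧ ∀ θ : ℝ, 0 < θ → θ ≤ θ₀ → ∀ᶠ x : ℕ in atTop,
      |θ ^ ((k : ℝ) * (y - 1)) *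
          ((∑ n ∈ range (x + 1), y ^ (∑ i, (((f i).eval (n : ℤ)).toNat.factorization.sum fun _ v => min v 2))) /
            (∑ n ∈ range (x + 1), y ^ (∑ i, (((f i).eval (n : ℤ)).toNat.factorization.sum
              fun p v => if p < ⌊(x : ℝ) ^ θ⌋₊ + 1 then min v 2 else 0)))) -
        Real.exp (-(Real.eulerMascheroniConstant * ((k : ℝ) * (y - 1)))) *
          (Real.exp ((y - 1) * Real.log (∏ i, ((f i).natDegree : ℝ))) * (Real.Gamma y)⁻¹ ^ k)| ≤ ε := by
  set κ : ℝ := (k : ℝ) * (y - 1) with hκ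
  have hκ0 : 0 ≤ κ := mul_nonneg (Nat.cast_nonneg _) (by linarith)
  have hy1 : 1 ≤ y := hy.le
  set P : ℝ := (eulerFactor f (y : ℂ)).re with hP
  have hPpos : 0 < P := eulerFactor_re_pos hf hy1
  set arch : ℝ := Real.exp ((y - 1) * Real.log (∏ i, ((f i).natDegree : ℝ))) * (Real.Gamma y)⁻¹ ^ k with harch
  have harchpos : 0 < arch := mul_pos (Real.exp_pos _) (pow_pos (inv_pos.2 (Real.Gamma_pos_of_pos (by linarith))) _)
  set γκ : ℝ := Real.exp (Real.eulerMascheroniConstant * κ) with hγκ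
  have hγκpos : 0 < γκ := Real.exp_pos _
  set Λ₀ : ℝ := P * γκ with hΛ₀
  have hΛ₀pos : 0 < Λ₀ := mul_pos hPpos hγκpos
  -- notation for the sums
  set Full : ℕ → ℝ := fun x => ∑ n ∈ range (x + 1),
      y ^ (∑ i, (((f i).eval (n : ℤ)).toNat.factorization.sum fun _ v => min v 2)) with hFull
  set Tr : ℝ → ℕ → ℝ := fun θ x => ∑ n ∈ range (x + 1), y ^ (∑ i, (((f i).eval (n : ℤ)).toNat.factorization.sum
      fun p v => if p < ⌊(x : ℝ) ^ θ⌋₊ + 1 then min v 2 else 0)) with hTr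
  set Nm : ℕ → ℝ := fun x => (x : ℝ) * Real.log x ^ κ with hNm
  have hNmpos : ∀ x : ℕ, 2 ≤ x → 0 < Nm x := fun x hx => by
    have hx2 : (2 : ℝ) ≤ x := by exact_mod_cast hx
    exact mul_pos (by linarith) (Real.rpow_pos_of_pos (Real.log_pos (by linarith)) _)
  have hTrpos : ∀ θ : ℝ, ∀ x : ℕ, 0 < Tr θ x := fun θ x => by
    simp only [hTr]
    exact Finset.sum_pos (fun n _ => pow_pos (by linarith) _) ⟨0, by simp⟩
  have hexpneg : Real.exp (-(Real.eulerMascheroniConstant * κ)) = γκ⁻¹ := by rw [Real.exp_neg]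
  have htarget : Real.exp (-(Real.eulerMascheroniConstant * κ)) * arch = (P * arch) / Λ₀ := by
    rw [hexpneg, hΛ₀]; field_simp
  constructor
  · -- (⇒): the full law and the truncated law give the tilted law
    intro hF ε hε
    -- accuracy targets
    have hA0 : 0 < P * arch := mul_pos hPpos harchpos
    set η : ℝ := min (Λ₀ / 2) (ε * Λ₀ ^ 2 / (4 * (P * arch + Λ₀))) with hη
    have hηpos : 0 < η := lt_min (by positivity) (by positivity)
    have hηΛ : η ≤ Λ₀ / 2 := min_le_left _ _
    have hηε : η ≤ ε * Λ₀ ^ 2 / (4 * (P * arch + Λ₀)) := min_le_right _ _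
    obtain ⟨θ₁, hθ₁, hrel⟩ := truncStat_law_relative hf hy1 hηpos
    refine ⟨θ₁, hθ₁, fun θ hθ hθle => ?_⟩
    have hθκ : 0 < θ ^ κ := Real.rpow_pos_of_pos hθ _
    have hFev := (Metric.tendsto_nhds.1 hF) η hηpos
    filter_upwards [hrel θ hθ hθle, hFev, eventually_ge_atTop 2] with x hxT hxF hx2
    have hN := hNmpos x hx2
    -- `Gθ := Tr/(θ^κ Nm) ≈ Λ₀`, `F := Full/Nm ≈ P arch`
    set Gθ : ℝ := Tr θ x / (θ ^ κ * Nm x) with hGθ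
    set F : ℝ := Full x / Nm x with hFdef
    have hxT' : |Gθ - Λ₀| ≤ η := hxT
    have hxF' : |F - P * arch| < η := by rw [← Real.dist_eq]; exact hxF
    have hGθpos : 0 < Gθ := div_pos (hTrpos θ x) (mul_pos hθκ hN)
    have hTr0 : Tr θ x ≠ 0 := (hTrpos θ x).ne'
    have hNm0 : Nm x ≠ 0 := hN.ne'
    have hθκ0 : θ ^ κ ≠ 0 := hθκ.ne'
    have hGθlow : Λ₀ / 2 ≤ Gθ := by
      have := (abs_le.1 hxT').1
      linarith
    -- the tilted quotient is `F / Gθ`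
    have hquot : θ ^ κ * (Full x / Tr θ x) = F / Gθ := by
      rw [hFdef, hGθ]
      field_simp
    rw [hquot, htarget]
    -- `F/Gθ − (P arch)/Λ₀ = (F − P arch)/Gθ + (P arch)(Λ₀ − Gθ)/(Gθ Λ₀)`
    have hsplit : F / Gθ - P * arch / Λ₀ = (F - P * arch) / Gθ + P * arch * (Λ₀ - Gθ) / (Gθ * Λ₀) := by
      field_simp
      ring
    rw [hsplit]
    have hb1 : |(F - P * arch) / Gθ| ≤ η / (Λ₀ / 2) := by
      rw [abs_div, abs_of_pos hGθpos]
      exact div_le_div₀ hηpos.le hxF'.le (by positivity) hGθlow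
    have hb2 : |P * arch * (Λ₀ - Gθ) / (Gθ * Λ₀)| ≤ P * arch * η / (Λ₀ / 2 * Λ₀) := by
      rw [abs_div, abs_mul, abs_of_pos hA0, abs_of_pos (mul_pos hGθpos hΛ₀pos)]
      refine div_le_div₀ (by positivity) ?_ (by positivity) ?_
      · rw [abs_sub_comm]; exact mul_le_mul_of_nonneg_left hxT' hA0.le
      · exact mul_le_mul_of_nonneg_right hGθlow hΛ₀pos.le
    calc |(F - P * arch) / Gθ + P * arch * (Λ₀ - Gθ) / (Gθ * Λ₀)|
        ≤ |(F - P * arch) / Gθ| + |P * arch * (Λ₀ - Gθ) / (Gθ * Λ₀)| := abs_add_le _ _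
      _ ≤ η / (Λ₀ / 2) + P * arch * η / (Λ₀ / 2 * Λ₀) := add_le_add hb1 hb2
      _ = η * (4 * (P * arch + Λ₀)) / (2 * Λ₀ ^ 2) := by field_simp; ring
      _ ≤ (ε * Λ₀ ^ 2 / (4 * (P * arch + Λ₀))) * (4 * (P * arch + Λ₀)) / (2 * Λ₀ ^ 2) := by
          gcongr
      _ = ε / 2 := by field_simp
      _ ≤ ε := by linarith
  · -- (⇐): the tilted law and the truncated law give the full law
    intro hT
    rw [Metric.tendsto_nhds]
    intro ε hε
    have hA0 : 0 < P * arch := mul_pos hPpos harchpos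
    -- accuracy targets: `|F − P arch| ≤ |Q − A/Λ₀| Gθ + (A/Λ₀)|Gθ − Λ₀|`
    set η : ℝ := min (min (Λ₀ / 2) 1) (ε / (4 * (Λ₀ + 1) * (P * arch / Λ₀ + 1))) with hη
    have hηpos : 0 < η := lt_min (lt_min (by positivity) one_pos) (by positivity)
    have hη1 : η ≤ 1 := (min_le_left _ _).trans (min_le_right _ _)
    have hηε : η ≤ ε / (4 * (Λ₀ + 1) * (P * arch / Λ₀ + 1)) := min_le_right _ _
    obtain ⟨θ₀, hθ₀, htilt⟩ := hT η hηpos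
    obtain ⟨θ₁, hθ₁, hrel⟩ := truncStat_law_relative hf hy1 hηpos
    set θ : ℝ := min θ₀ θ₁ with hθdef
    have hθ : 0 < θ := lt_min hθ₀ hθ₁
    have hθκ : 0 < θ ^ κ := Real.rpow_pos_of_pos hθ _
    filter_upwards [htilt θ hθ (min_le_left _ _), hrel θ hθ (min_le_right _ _), eventually_ge_atTop 2]
      with x hxQ hxT hx2
    have hN := hNmpos x hx2
    set Gθ : ℝ := Tr θ x / (θ ^ κ * Nm x) with hGθ
    set F : ℝ := Full x / Nm x with hFdef
    set Q : ℝ := θ ^ κ * (Full x / Tr θ x) with hQ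
    have hxT' : |Gθ - Λ₀| ≤ η := hxT
    rw [htarget] at hxQ
    have hxQ' : |Q - P * arch / Λ₀| ≤ η := hxQ
    have hGθpos : 0 < Gθ := div_pos (hTrpos θ x) (mul_pos hθκ hN)
    have hTr0 : Tr θ x ≠ 0 := (hTrpos θ x).ne'
    have hNm0 : Nm x ≠ 0 := hN.ne'
    have hθκ0 : θ ^ κ ≠ 0 := hθκ.ne'
    have hGθup : Gθ ≤ Λ₀ + 1 := by
      have := (abs_le.1 hxT').2
      linarith [hη1]
    have hFQ : F = Q * Gθ := by
      rw [hFdef, hQ, hGθ]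
      field_simp
    rw [Real.dist_eq]
    show |Full x / Nm x - P * arch| < ε
    rw [← hFdef, hFQ]
    have hsplit : Q * Gθ - P * arch = (Q - P * arch / Λ₀) * Gθ + P * arch / Λ₀ * (Gθ - Λ₀) := by
      field_simp
      ring
    rw [hsplit]
    have hb1 : |(Q - P * arch / Λ₀) * Gθ| ≤ η * (Λ₀ + 1) := by
      rw [abs_mul, abs_of_pos hGθpos]
      exact mul_le_mul hxQ' hGθup hGθpos.le hηpos.le
    have hb2 : |P * arch / Λ₀ * (Gθ - Λ₀)| ≤ P * arch / Λ₀ * η := by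
      rw [abs_mul, abs_of_pos (div_pos hA0 hΛ₀pos)]
      exact mul_le_mul_of_nonneg_left hxT' (by positivity)
    calc |(Q - P * arch / Λ₀) * Gθ + P * arch / Λ₀ * (Gθ - Λ₀)|
        ≤ |(Q - P * arch / Λ₀) * Gθ| + |P * arch / Λ₀ * (Gθ - Λ₀)| := abs_add_le _ _
      _ ≤ η * (Λ₀ + 1) + P * arch / Λ₀ * η := add_le_add hb1 hb2
      _ ≤ η * ((Λ₀ + 1) * (P * arch / Λ₀ + 1)) := by
          have h1 : 0 ≤ P * arch / Λ₀ := by positivity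
          nlinarith
      _ ≤ ε / (4 * (Λ₀ + 1) * (P * arch / Λ₀ + 1)) * ((Λ₀ + 1) * (P * arch / Λ₀ + 1)) :=
          mul_le_mul_of_nonneg_right hηε (by positivity)
      _ = ε / 4 := by field_simp
      _ < ε := by linarith

/-- **The open kernel law IS the tilted law of the large prime factors.**  For a Bateman–Horn system `f` and real
`y > 1`: `BetaKernelLaw k f y` (the registered open content of the crux at `(f, y)`, equivalent to the crux's segment law
at `y` with `Λ = λ_f` by `betaKernelLaw_iff_segmentLaw`) holds iff for every `ε > 0` and all small `θ > 0`, eventually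
`|θ^{k(y−1)} · E^{(y,θ)}_x[y^{s_f − s_{f,⌊x^θ⌋₊+1}}] − e^{−γk(y−1)} e^{(y−1)log D} Γ(y)^{−k}| ≤ ε`, where `E^{(y,θ)}_x` is the
expectation over `0 ≤ n ≤ x` tilted by `y^{s_{f,⌊x^θ⌋₊+1}(n)}`. [folklore] -/
theorem betaKernelLaw_iff_tiltedRoughLaw (hf : IsBatemanHornSystem f) {y : ℝ} (hy : 1 < y) :
    BetaKernelLaw k f y ↔
    ∀ ε : ℝ, 0 < ε → ∃ θ₀ : ℝ, 0 < θ₀ ∧ ∀ θ : ℝ, 0 < θ → θ ≤ θ₀ → ∀ᶠ x : ℕ in atTop,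
      |θ ^ ((k : ℝ) * (y - 1)) *
          ((∑ n ∈ range (x + 1), y ^ (∑ i, (((f i).eval (n : ℤ)).toNat.factorization.sum fun _ v => min v 2))) /
            (∑ n ∈ range (x + 1), y ^ (∑ i, (((f i).eval (n : ℤ)).toNat.factorization.sum
              fun p v => if p < ⌊(x : ℝ) ^ θ⌋₊ + 1 then min v 2 else 0)))) -
        Real.exp (-(Real.eulerMascheroniConstant * ((k : ℝ) * (y - 1)))) *
          (Real.exp ((y - 1) * Real.log (∏ i, ((f i).natDegree : ℝ))) * (Real.Gamma y)⁻¹ ^ k)| ≤ ε := by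
  rw [betaKernelLaw_iff_segmentLaw hf hy, segmentLaw_iff_tendsto_real hf hy.le]
  exact segmentLawReal_iff_tiltedRoughLaw hf hy

end Tilted

/-! ### Registered closed form -/

/-- **betaKernelLawIffTiltedRoughLaw** (registered closed form, `--supports stmt-Parity-11292`): for every Bateman–Horn
system and every real `y > 1`, the open kernel law at `(f, y)` is equivalent to the `y`-tilted law of the prime factors
above `x^θ` (all small `θ`), with the universal constant `e^{−γk(y−1)} D^{y−1} Γ(y)^{−k} θ^{−k(y−1)}`. [folklore] -/
theorem betaKernelLawIffTiltedRoughLaw : ∀ (k : ℕ) (f : Fin k → ℤ[X]), IsBatemanHornSystem f → ∀ y : ℝ, 1 < y → (BetaKernelLaw k f y ↔ ∀ ε : ℝ, 0 < ε → ∃ θ₀ : ℝ, 0 < θ₀ ∧ ∀ θ : ℝ, 0 < θ → θ ≤ θ₀ → ∀ᶠ x : ℕ in atTop, |θ ^ ((k : ℝ) * (y - 1)) * ((∑ n ∈ Finset.range (x + 1), y ^ (∑ i, (((f i).eval (n : ℤ)).toNat.factorization.sum fun _ v => min v 2))) / (∑ n ∈ Finset.range (x + 1), y ^ (∑ i, (((f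 i).eval (n : ℤ)).toNat.factorization.sum fun p v => if p < ⌊(x : ℝ) ^ θ⌋₊ + 1 then min v 2 else 0)))) - Real.exp (-(Real.eulerMascheroniConstant * ((k : ℝ) * (y - 1)))) * (Real.exp ((y - 1) * Real.log (∏ i, ((f i).natDegree : ℝ))) * (Real.Gamma y)⁻¹ ^ k)| ≤ ε) :=
  fun _k _f hf _y hy => betaKernelLaw_iff_tiltedRoughLaw hf hy

end

end Summit.Parity.BatemanHorn.Cruxes.SystemLSDRealSegment.BetaThinnedRootKernel
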